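import Summits.Ventures.Crystal3D.Theorems.StickyWulffConstantCoaxialWallLawSeamFullEndUnsaturated
import Summits.Ventures.Crystal3D.Theorems.StickyWulffConstantCoaxialWallLawSeamVacancyCensus
import HarnessLib

/-!
# The PRINCIPAL ROW of `SatCensus11Full`: a deg-11 FULL-reader end ball whose four common neighbours are saturated single-grain balls has the VACANCY
# SHELL `cubo ∖ {u}`, hence two unsaturated neighbours (modulo `VacancyCapFcc`)
# (crux `CoaxialWallLaw`, stmt-Ventures-19481; lane F 'Certificates' v8.3R, registered stub `stub_threePayer`, (L2) split piece `SatCensus11Full`)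

HONEST FRAMING. Venture `Summits/Ventures/Crystal3D` (cell `crystal3d-full`); sequel of '…SeamFullEndUnsaturated' and '…SeamVacancyCensus'.  Seat 19481-p2 g14's exact
enumeration (HOME/wall-19481-p2/g14-calc/fullreader_enum.py) of the deg-11 FULL-reader case under E1: each SATURATED common neighbour `nₛ = b + G s` (`⟪s, −u⟫ = ½`)
of the end ball `b = q + G u` and its FULL reader `q` carries a closed slot star, so (E1, `shell_slots_or_twin_of_star_twelve`) its dozen is the `G`-slot dozen or one of
two twins; 85 consistent combinations.  THIS FILE proves the PRINCIPAL row in the kernel — all four common neighbours saturated with SLOT-TYPE shells (every contact of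
`nₛ` is a slot ball `nₛ + G w`; no twinning next to `b`): then the closed stars of the four `s` are occupied around `b`, and together with the star of `−u` they
cover every slot of `b` except `u` (cuboctahedron combinatorics, `decide`); `b + G u` is absent since `b` is not moving (not FULL).  So `b`'s shell is the
VACANCY SHELL and `two_unsaturated_of_fccVacancyShell` applies.
* `negIdx`, `star_cover` (tables; `inner_slotSite_eq_half_of_dot` of '…TwinReaderRigidity'); `slots_occupied_of_saturated_slotType` — a saturated ball all of whose contacts are slot balls has all twelve slots occupied;
* **`vacancyShell_of_full_end_slotType`** — the eleven slots `b + G(slot l)`, `l ≠ k` (`slot k = u`), are occupied and `b + G u` is not;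
* **`two_unsaturated_of_full_end_slotType : KissingGap (5/2) → VacancyCapFcc → … → two distinct contact-neighbours of `b` with ≤ 11 contacts`**.
The twin-type rows (a common neighbour with an anticuboctahedral shell keeping its star on the own side) are NOT treated: they force mirror balls next to `b`
and need their own cap rows (memo F-TAIL-g14 §5).
WHAT THIS IS NOT: not `SatCensus11Full`; F-C1 not moved.
-/

noncomputable section

namespace Summit.Ventures.Crystal3D.Theorems

namespace TailResidue

open Summit.Ventures.Crystal3D Finset NearIdentity
open scoped InnerProductSpace

variable {X : Finset (EuclideanSpace ℝ (Fin 3))}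

/-! ### Tables -/

/-- The antipodal slot index. -/
def negIdx : Fin 12 → Fin 12 := ![3, 2, 1, 0, 7, 6, 5, 4, 11, 10, 9, 8]

/-- `slot (negIdx k) = − slot k` (integer model). -/
theorem slotInt_negIdx : ∀ k : Fin 12, slotInt (negIdx k) = -slotInt k := by decide

/-- **Star cover**: every slot `t ≠ k` lies in the closed star of `−slot k` or in the closed star of one of the four neighbours of `−slot k`. -/
theorem star_cover : ∀ k t : Fin 12, t ≠ k →
    t = negIdx k ∨ slotInt t ⬝ᵥ slotInt (negIdx k) = 1 ∨ ∃ i : Fin 4, t = slotNbr (negIdx k) i ∨ slotInt t ⬝ᵥ slotInt (slotNbr (negIdx k) i) = 1 := by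
  decide

/-- Real form of the antipode table. -/
theorem slotSite_negIdx (k : Fin 12) : slotSite (negIdx k) = -slotSite k := slotSite_eq_neg (slotInt_negIdx k)

/-! ### A saturated single-grain ball has all its slots occupied -/

open scoped Classical in
/-- **Twelve contacts, all slot balls ⇒ every slot occupied.** -/
theorem slots_occupied_of_saturated_slotType (G : EuclideanSpace ℝ (Fin 3) ≃ₗᵢ[ℝ] EuclideanSpace ℝ (Fin 3)) {y : EuclideanSpace ℝ (Fin 3)}
    (h12 : (X.filter fun c => dist y c = 1).card = 12) (hslot : ∀ c ∈ X, dist y c = 1 → ∃ w ∈ fccSlots, c = y + G w) :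
    ∀ w ∈ fccSlots, y + G w ∈ X := by
  set C := X.filter fun c => dist y c = 1 with hC
  set I := fccSlots.image fun w => y + G w with hI
  have hCI : C ⊆ I := by
    intro c hc
    obtain ⟨hcX, hcd⟩ := mem_filter.1 hc
    obtain ⟨w, hw, rfl⟩ := hslot c hcX hcd
    exact mem_image.2 ⟨w, hw, rfl⟩
  have hIC : I ⊆ C := (eq_of_subset_of_card_le hCI (by rw [card_image_frame G y, h12])).symm.subset
  intro w hw
  exact (mem_filter.1 (hIC (mem_image.2 ⟨w, hw, rfl⟩))).1

/-! ### The vacancy shell at a FULL-reader end with saturated single-grain common neighbours -/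

open scoped Classical in
/-- **VACANCY SHELL OF THE PRINCIPAL ROW.**  `q ∈ X` FULL in `G`; `u = slot k`; `b = q + G u` not moving in `(G, G u)`; every common neighbour
`b + G s` (`s` a slot with `⟪s, −u⟫ = ½`) has twelve contacts, all of them slot balls `b + G s + G w`.  Then the eleven slot balls `b + G(slot l)`, `l ≠ k`, are present
and `b + G u` is absent. -/
theorem vacancyShell_of_full_end_slotType {v : WordVersion} (G : EuclideanSpace ℝ (Fin 3) ≃ₗᵢ[ℝ] EuclideanSpace ℝ (Fin 3))
    {b q : EuclideanSpace ℝ (Fin 3)} {k : Fin 12} (hq : q ∈ X) (hfull : IsFull X G q) (hbq : b = q + G (slotSite k)) (hnm : ¬ IsMoving X v G (G (slotSite k)) b)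
    (hsat : ∀ s ∈ fccSlots, ⟪s, -slotSite k⟫_ℝ = 1 / 2 → (X.filter fun c => dist (b + G s) c = 1).card = 12)
    (hslot : ∀ s ∈ fccSlots, ⟪s, -slotSite k⟫_ℝ = 1 / 2 → ∀ c ∈ X, dist (b + G s) c = 1 → ∃ w ∈ fccSlots, c = b + G s + G w) :
    (∀ l : Fin 12, l ≠ k → b + G (slotSite l) ∈ X) ∧ b + G (slotSite k) ∉ X := by
  have hstar := star_occupied_of_full_reader G hq (slotSite_mem k) hfull hbq
  -- the closed star of a saturated single-grain common neighbour is occupied around `b`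
  have hnbr_star : ∀ i : Fin 4, ∀ t : Fin 12, (t = slotNbr (negIdx k) i ∨ slotInt t ⬝ᵥ slotInt (slotNbr (negIdx k) i) = 1) → b + G (slotSite t) ∈ X := by
    intro i t ht
    set s := slotSite (slotNbr (negIdx k) i) with hs
    have hsu : ⟪s, -slotSite k⟫_ℝ = 1 / 2 := by rw [← slotSite_negIdx, hs]; exact inner_slotSite_eq_half_of_dot (by rw [dotProduct_comm]; exact slotNbr_spec.1 _ i)
    have hsX : b + G s ∈ X := hstar s (slotSite_mem _) (by rw [hsu]; norm_num)
    rcases ht with rfl | hdot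
    · exact hsX
    · have hall := slots_occupied_of_saturated_slotType G (hsat s (slotSite_mem _) hsu) (hslot s (slotSite_mem _) hsu)
      have hw : slotSite t - s ∈ fccSlots := sub_mem_fccSlots_of_inner_eq_half (slotSite_mem t) (slotSite_mem _) (inner_slotSite_eq_half_of_dot hdot)
      have e : b + G (slotSite t) = b + G s + G (slotSite t - s) := by rw [map_sub]; abel
      rw [e]; exact hall _ hw
  refine ⟨fun l hl => ?_, fun hmem => ?_⟩
  · rcases star_cover k l hl with h | h | ⟨i, hi⟩
    · rw [h, slotSite_negIdx, map_neg, hbq, add_neg_cancel_right]; exact hq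
    · exact hstar _ (slotSite_mem l) (by rw [← slotSite_negIdx, inner_slotSite_eq_half_of_dot h]; norm_num)
    · exact hnbr_star i l hi
  · -- all twelve slots occupied: `b` is FULL, hence moving
    apply hnm
    left
    intro w hw
    obtain ⟨l, rfl⟩ := exists_slotSite_eq hw
    by_cases hl : l = k
    · rw [hl]; exact hmem
    · rcases star_cover k l hl with h | h | ⟨i, hi⟩
      · rw [h, slotSite_negIdx, map_neg, hbq, add_neg_cancel_right]; exact hq
      · exact hstar _ (slotSite_mem l) (by rw [← slotSite_negIdx, inner_slotSite_eq_half_of_dot h]; norm_num)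
      · exact hnbr_star i l hi

open scoped Classical in
/-- **THE PRINCIPAL ROW OF `SatCensus11Full`.**  Under GAP(5/2) and `VacancyCapFcc`: at a FULL-reader end ball `b = q + G u` (not moving) whose four common neighbours with
`q` are saturated single-grain balls, two distinct contact-neighbours of `b` have at most eleven contacts (the deg-11 hypothesis is not even needed: the shell is forced
to be the vacancy shell). -/
theorem two_unsaturated_of_full_end_slotType (hg : KissingGap (5 / 2)) (hcap : VacancyCapFcc) (hX : ∀ p ∈ X, ∀ p' ∈ X, p ≠ p' → 1 ≤ dist p p') {v : WordVersion}
    (G : EuclideanSpace ℝ (Fin 3) ≃ₗᵢ[ℝ] EuclideanSpace ℝ (Fin 3)) {b q : EuclideanSpace ℝ (Fin 3)} {k : Fin 12} (hq : q ∈ X) (hb : b ∈ X) (hfull : IsFull X G q)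
    (hbq : b = q + G (slotSite k)) (hnm : ¬ IsMoving X v G (G (slotSite k)) b)
    (hsat : ∀ s ∈ fccSlots, ⟪s, -slotSite k⟫_ℝ = 1 / 2 → (X.filter fun c => dist (b + G s) c = 1).card = 12)
    (hslot : ∀ s ∈ fccSlots, ⟪s, -slotSite k⟫_ℝ = 1 / 2 → ∀ c ∈ X, dist (b + G s) c = 1 → ∃ w ∈ fccSlots, c = b + G s + G w) :
    ∃ y ∈ X, ∃ y' ∈ X, y ≠ y' ∧ dist b y = 1 ∧ dist b y' = 1 ∧
      (X.filter fun x => dist y x = 1).card ≤ 11 ∧ (X.filter fun x => dist y' x = 1).card ≤ 11 := by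
  obtain ⟨hocc, hvac⟩ := vacancyShell_of_full_end_slotType G hq hfull hbq hnm hsat hslot
  exact two_unsaturated_of_fccVacancyShell hg hcap hX G hb hocc hvac

end TailResidue

end Summit.Ventures.Crystal3D.Theorems

end
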